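import Summits.QuantumFields.YangMills.Theorems.UnitScaleTiltHalvingP1FlatCoreChartDataDoor
import Summits.QuantumFields.YangMills.Theorems.UnitScaleTiltHalvingP1FlatCoreExtractionMult
import HarnessLib

/-!
# `hP1room` PROGRAMME (LEAD-H «H = hP1room» BOARD v1, RULING L-9 (1)), (A-1) STAGE 1b: ★★★ THE FAMILY DOOR — THE ROOMED `P1FlatPillar′` TEXT (THE BODY OF `hP1room`)
# FROM ONE DISPLAYED PER-SITE SUPPLIER BINDER `hSup` (N05 ∕ J3 DATA + TOP-STEP FRAMES + SIZES), THROUGH STAGE 1's PER-SITE DOOR AND THE MULTIPLIER-CURRENCY ENTRY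

Route `UnitScaleTilt`, crux K1 child «MinimiserStabilityRegPr» (stmt-QuantumFields-19200), registered stub `stub_halvingStep` (`BirthV10`), text `hP1room` (H door of record
✓`HalvingStubOfHP1Room.stub_halvingStep_of_hP1room`).  := ✓`HalvingP1FlatCoreExtractionMult.p1FlatPillar'_room_of_mlogChartDataMult` ∘
✓`HalvingP1FlatCoreChartDataDoor.mlogChartDataMult_of_suppliers_cubeLamS`, with J1b's geometry DISCHARGED (✓`P1FlatCoreCubeInclusion.corner_of_offset` for the corner
`a := Bᵏx₀ − t`, ✓`room_of_level_k` + ✓`P1FlatCoreDP1Target.sitesPerDir_top_eq` for the no-wrap room from the constants premise `M′ + 1 + 2ρ′ ≤ 2ρ + N_r`) and the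
regularity letters read off `U ∈ regFibrePr` (✓`mem_regFibrePr_iff`) and `ε₀ ≤ a ≤ (10⁷L³)⁻¹`.

THE ONE DISPLAYED INPUT `hSup` (shape = ★w3-20520 g5 13:54Z default «one ∃-block per member∕site», `(M′, ρ′)` outer constants): for every member `(F, F.L = L, n < K)` with room
`2ρ + N_r ≤ L^{m+n}`, every `(ε₀, ε₁)` in the P1 windows, every (7)-datum `V` and `U ∈ regFibrePr`, and every site `x₀`: an offset `t ∈ [0, M′−1]`, the `ℤ³` gauge `w`, one-form
`X` and multiplier `μ` of N05's k-level member at the window `cube L (Bᵏx₀ − t) M′ ρ′ k 0` with the chart rows `hWnear`∕`hX` (η = L^{−k}) and the flat Landau window `hLan` at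
N05's restriction tower `cubeLamS`, the top-step frames `g h′ κ′ ν gs′` with their recursions, `hug`, `htop`, and the two (1.36)♭ size rows of `A := X ∘ rep`.

HONEST SCOPE: plumbing; `hSup` is DISPLAYED (its suppliers: N05's k-level output + ✓p636261 top step + (R4) sizes — LEAD-H's board (b)(c), STAGE 2∕3).  Rung R3 (YM₃ on T³),
NOT the Clay problem; no stub∕crux is claimed.  `--supports stmt-QuantumFields-19200 --as helper`.

References: T. Bałaban, CMP **99** (1985) 75–102 [Balaban1985RegularSpaces] (Thm 2 p.83, (1.36)–(1.38) p.82, p.98); CMP **102** (1985) 277–309 [Balaban1985Variational]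
((144) p.300, (150)–(156) pp.301–302).
-/

set_option autoImplicit false

noncomputable section

open scoped BigOperators Matrix.Norms.L2Operator

namespace Summit.QuantumFields.YangMills.Theorems.HalvingP1FlatCoreFamilyDoor

open Literature.MathematicalPhysics.QuantumFieldTheory.Balaban1983to89
open Literature.MathematicalPhysics.QuantumFieldTheory.Balaban1983to89.T3ContinuumYM3Torus
open Literature.MathematicalPhysics.QuantumFieldTheory.Balaban1983to89.T3PrintedRegularMinimiser
open T4Continuum BlockAveraging ExpMeanLog T3RegularMinimiser
open Complex (I)
open MatrixLog (mlog)
open B5Eq118OneStroke (iterBlockOf)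
open B6SectAOperatorsV1 (SiteIdx)
open B7Prop1Explicit renaming Site → LSite
open B7Prop1Explicit (e)
open B7Prop1Local (InBox)
open B8Eq131Cubes (cube flm gs sqLo sqHi)
open B8Eq138LandauZd (covDivB covLap QT)
open B8CubeMemberZd (cubeLamS)
open B10Eq27TorusAxialLog (transl rel unitsField toUField suIncl gaugeActT axialT)
open B15Eq112TorusCover (lift)
open Node00 (coverAt)
open LatticeFieldCalculus (laplace diverg siteAvgIter)
open FlatCubeOpsText (IsLevWeight)
open FlatCubeSequenceAligned (cubeSeqMT3 cubeSetM)
open Summit.QuantumFields.YangMills.Theorems.Prop8ChartDoubleBar (dbarIterU vframeU)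
open HalvingP1FlatPillar (DP1Clause)
open HalvingP1FlatPillarPrime (P1FlatPillarAt')
open HalvingP1FlatCoreExtractionMult (p1FlatPillar'_room_of_mlogChartDataMult)
open HalvingP1FlatCoreChartDataDoor (mlogChartDataMult_of_suppliers_cubeLamS)
open P1FlatCoreCubeInclusion (corner_of_offset room_of_level_k)
open P1FlatCoreDP1Target (sitesPerDir_top_eq)

open Classical in
/-- ★★★ **THE FAMILY DOOR OF (A-1): THE ROOMED `P1FlatPillar′` TEXT FROM THE DISPLAYED PER-SITE SUPPLIER BINDER `hSup`.**  Outer constants as in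
✓`p1FlatPillar'_room_of_mlogChartDataMult` plus `(M′, ρ′)` (N05's member sizes, `2 ≤ ρ′`, `ρ + M ≤ ρ′ + 1`, `L + S + M ≤ ρ′ + 2`), the room split `M′ + 1 + 2ρ′ ≤ 2ρ + N_r`,
`M ≤ N_r`, `2 ≤ S`, and `10⁷L³a ≤ 1`. [cite: Balaban1985RegularSpaces, Thm 2 p.83, (1.36)-(1.38) p.82; Balaban1985Variational, (144) p.300, (150)-(156) pp.301-302] -/
theorem p1FlatPillar'_room_of_suppliers (L ρ S M Nr : ℕ) (hM : 1 ≤ M) {R' : ℕ} (hRS : R' * M ≤ S) (hRM : 2 * L ≤ R' * M + 1) (hS : 2 ≤ S) (hNr : M ≤ Nr)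
    {a Cr B₁ : ℝ} (hCr : 0 < Cr) (hreg₁ : 12 * ((ρ : ℝ) + (M : ℝ)) * a ≤ Cr)
    (hreg₀ : 16 * 3800 * ((5 * L : ℕ) : ℝ) ^ 2 * (L : ℝ) * ((B₁ + 1) * a) ≤ 1) (hB₁ : 0 ≤ B₁ + 1) (ha7 : 10 ^ 7 * (L : ℝ) ^ 3 * a ≤ 1)
    (M' ρ' : ℕ) (hρ' : 2 ≤ ρ') (h0 : ρ + M ≤ ρ' + 1) (h1 : L + S + M ≤ ρ' + 2) (hNrW : M' + 1 + 2 * ρ' ≤ 2 * ρ + Nr)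
    (hSup : ∀ F : T3Family, F.L = L → ∀ (n K : ℕ) (hnK : n < K), 2 * ρ + Nr ≤ F.L ^ (F.m + n) → ∀ (ε₀ ε₁ : ℝ), 0 < ε₁ → 0 < ε₀ → ε₀ ≤ a → Cr * ε₁ ≤ ε₀ →
      ∀ V : GaugeField (F.P n) 0 (Matrix.specialUnitaryGroup (Fin 2) ℂ), PlaqSmall ε₁ V →
        ∀ U ∈ regFibrePr F n K hnK.le ε₀ V, ∀ x₀ : Site (F.P K) 0,
          ∃ (t : ℤ) (_ : 0 ≤ t) (_ : t ≤ (M' : ℤ) - 1)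
            (w : LSite (F.P K).d → Matrix.specialUnitaryGroup (Fin 2) ℂ) (X : LSite (F.P K).d → Fin (F.P K).d → Matrix (Fin 2) (Fin 2) ℂ)
            (μ : ℕ → LSite (F.P K).d → Matrix (Fin 2) (Fin 2) ℂ)
            (g h' : GaugeTransf (F.P K) 0 (Matrix (Fin 2) (Fin 2) ℂ)ˣ) (κ' : (i : ℕ) → GaugeTransf (F.P K) i (Matrix (Fin 2) (Fin 2) ℂ)ˣ)
            (ν : (i : ℕ) → Site (F.P K) i → (Matrix (Fin 2) (Fin 2) ℂ)ˣ) (gs' : (i : ℕ) → GaugeTransf (F.P K) i (Matrix (Fin 2) (Fin 2) ℂ)ˣ),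
            -- [N05 ∕ J3] chart rows and flat Landau window at the corner `a := Bᵏx₀ − t`
            (∀ z ∈ cube (F.P K).L (fun μ => ((iterBlockOf (K - n) x₀ μ).val : ℤ) - t) M' ρ' (K - n) 0, ∀ ν : Fin (F.P K).d,
              transl (0 : Site (F.P K) 0) z ∈ cubeSetM x₀ (K - n) ρ S M 0 → (transl (0 : Site (F.P K) 0) z).shift ν ∈ cubeSetM x₀ (K - n) ρ S M 0 →
              ‖(((Unitary.toUnits (suIncl (w z)))⁻¹ * unitsField (toUField U) ⟨transl 0 z, ν⟩ * Unitary.toUnits (suIncl (w (z + e ν))) :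
                  (Matrix (Fin 2) (Fin 2) ℂ)ˣ) : Matrix (Fin 2) (Fin 2) ℂ) - 1‖ ≤ 1 / 4) ∧
            (∀ z ∈ cube (F.P K).L (fun μ => ((iterBlockOf (K - n) x₀ μ).val : ℤ) - t) M' ρ' (K - n) 0, ∀ ν : Fin (F.P K).d,
              transl (0 : Site (F.P K) 0) z ∈ cubeSetM x₀ (K - n) ρ S M 0 → (transl (0 : Site (F.P K) 0) z).shift ν ∈ cubeSetM x₀ (K - n) ρ S M 0 →
              I • ((((F.L : ℝ)⁻¹) ^ (K - n)) • X z ν) = mlog (((Unitary.toUnits (suIncl (w z)))⁻¹ * unitsField (toUField U) ⟨transl 0 z, ν⟩ *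
                  Unitary.toUnits (suIncl (w (z + e ν))) : (Matrix (Fin 2) (Fin 2) ℂ)ˣ) : Matrix (Fin 2) (Fin 2) ℂ)) ∧
            (∀ z ∈ cube (F.P K).L (fun μ => ((iterBlockOf (K - n) x₀ μ).val : ℤ) - t) M' ρ' (K - n) 0,
              covLap (((F.L : ℝ)⁻¹) ^ (K - n)) (1 : LSite (F.P K).d → Fin (F.P K).d → (Matrix (Fin 2) (Fin 2) ℂ)ˣ)
                  ((cube (F.P K).L (fun μ => ((iterBlockOf (K - n) x₀ μ).val : ℤ) - t) M' ρ' (K - n) 0).indicator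
                    (covDivB (((F.L : ℝ)⁻¹) ^ (K - n)) (1 : LSite (F.P K).d → Fin (F.P K).d → (Matrix (Fin 2) (Fin 2) ℂ)ˣ) X)) z =
                QT (F.P K).L (K - n) (cubeLamS (F.P K).L (fun μ => ((iterBlockOf (K - n) x₀ μ).val : ℤ) - t) M' ρ' (K - n) (K - n))
                  (1 : LSite (F.P K).d → Fin (F.P K).d → (Matrix (Fin 2) (Fin 2) ℂ)ˣ) μ z) ∧
            -- [top step] frames, composite gauge, top identity
            κ' 0 = h' ∧
            (∀ (i : ℕ) (y : Site (F.P K) (i + 1)),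
              κ' (i + 1) y = (vframeU (gaugeActT (κ' i) (dbarIterU i (gaugeActT g (unitsField (toUField U))))) y)⁻¹ * κ' i (emb y) *
                vframeU (dbarIterU i (gaugeActT g (unitsField (toUField U)))) y) ∧
            (∀ s, ν 0 s = 1) ∧
            (∀ (i : ℕ) (y : Site (F.P K) (i + 1)), ν (i + 1) y = ν i (emb y) * vframeU (dbarIterU i (gaugeActT g (unitsField (toUField U)))) y) ∧
            gs' 0 = g ∧ (∀ (i : ℕ) (y : Site (F.P K) (i + 1)), gs' (i + 1) y = gs' i (emb y)) ∧
            (∀ s, (Unitary.toUnits (suIncl (w (lift (F.P K) x₀ + rel x₀ s))))⁻¹ =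
              ((gs' (K - n) (iterBlockOf (K - n) x₀))⁻¹ * ν (K - n) (iterBlockOf (K - n) x₀)) * h' s * g s) ∧
            (∀ yc ∈ cubeLamS (F.P K).L (fun μ => ((iterBlockOf (K - n) x₀ μ).val : ℤ) - t) M' ρ' (K - n) (K - n) (K - n),
              κ' (K - n) (coverAt (F.P K) (K - n) yc) =
                axialT (dbarIterU (K - n) (gaugeActT g (unitsField (toUField U)))) (iterBlockOf (K - n) x₀) (coverAt (F.P K) (K - n) yc)) ∧
            -- [sizes] the two (1.36)♭ rows of `A := X ∘ rep`
            (∀ wt : ℕ → PBond (F.P K) 0 → ℝ, IsLevWeight F n K (cubeSeqMT3 F n K x₀ ρ S M hM) wt →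
              (∀ b : PBond (F.P K) 0, wt 1 b *
                ‖(fun b : PBond (F.P K) 0 => if b.src ∈ cubeSetM x₀ (K - n) ρ S M 0 ∧ b.tgt ∈ cubeSetM x₀ (K - n) ρ S M 0 then
                  X (lift (F.P K) x₀ + rel x₀ b.src) b.dir else 0) b‖ ≤ B₁ * ε₀) ∧
              (∀ (b : PBond (F.P K) 0) (ν' : Fin (F.P K).d), wt 2 b * (F.L : ℝ) ^ (K - n) *
                ‖(fun b : PBond (F.P K) 0 => if b.src ∈ cubeSetM x₀ (K - n) ρ S M 0 ∧ b.tgt ∈ cubeSetM x₀ (K - n) ρ S M 0 then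
                    X (lift (F.P K) x₀ + rel x₀ b.src) b.dir else 0) ⟨b.src.shift ν', b.dir⟩ -
                  (fun b : PBond (F.P K) 0 => if b.src ∈ cubeSetM x₀ (K - n) ρ S M 0 ∧ b.tgt ∈ cubeSetM x₀ (K - n) ρ S M 0 then
                    X (lift (F.P K) x₀ + rel x₀ b.src) b.dir else 0) b‖ ≤ B₁ * ε₀))) :
    ∀ F : T3Family, F.L = L → ∀ (n K : ℕ) (hnK : n < K), 2 * ρ + Nr ≤ F.L ^ (F.m + n) → ∀ (ε₀ ε₁ : ℝ), 0 < ε₁ → 0 < ε₀ → ε₀ ≤ a → Cr * ε₁ ≤ ε₀ →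
      ∀ V : GaugeField (F.P n) 0 (Matrix.specialUnitaryGroup (Fin 2) ℂ), PlaqSmall ε₁ V →
        ∀ U ∈ regFibrePr F n K hnK.le ε₀ V, ∀ x : Site (F.P K) 0,
          P1FlatPillarAt' F n K (cubeSeqMT3 F n K x ρ S M hM) (cubeSetM x (K - n) ρ S M 0) x ε₀ ε₁ B₁ 6 (8 * (L : ℝ) * (B₁ + 1)) U := by
  refine p1FlatPillar'_room_of_mlogChartDataMult L ρ S M Nr hM hRS hRM (by omega) hCr hreg₁ hreg₀ hB₁
    fun F hF n K hnK hroom ε₀ ε₁ hε₁ hε₀ hε₀a hCrε V hV U hU x₀ => ?_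
  obtain ⟨t, ht0, ht, w, X, μ, g, h', κ', ν, gs', hWnear, hX, hLan, h0', hs', hν0, hνs, hg0, hgs, hug, htop, hsize⟩ :=
    hSup F hF n K hnK hroom ε₀ ε₁ hε₁ hε₀ hε₀a hCrε V hV U hU x₀
  -- the regularity letters of the member field
  have hUreg : RegPr F n K ε₀ U := ((mem_regFibrePr_iff F).1 hU).2
  have hε7 : 10 ^ 7 * (F.L : ℝ) ^ 3 * ε₀ ≤ 1 := by
    rw [hF]
    have h10 : (0 : ℝ) ≤ 10 ^ 7 * (L : ℝ) ^ 3 := by positivity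
    exact (mul_le_mul_of_nonneg_left hε₀a h10).trans ha7
  -- J1b's geometry: the window size in member letters and the no-wrap room at level `k`
  have h1' : (F.P K).L + S + M ≤ ρ' + 2 := by rw [show (F.P K).L = F.L from rfl, hF]; exact h1
  have hk : K - n ≤ (F.P K).m + (F.P K).K := by show K - n ≤ F.m + K; omega
  have hroomk : 2 * (M' + 1 + 2 * ρ') ≤ (F.P K).sitesPerDir (K - n) := by
    rw [sitesPerDir_top_eq F n K hnK.le]
    omega
  exact mlogChartDataMult_of_suppliers_cubeLamS hnK x₀ ρ S M Nr hM hS hNr hroom hρ' h0 h1' (corner_of_offset x₀ (K - n) ht0 ht)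
    (room_of_level_k hk hroomk) U hε₀ hε7 hUreg.plaqSmall w X μ hWnear hX hLan g h' κ' h0' hs' ν hν0 hνs gs' hg0 hgs hug htop hsize

end Summit.QuantumFields.YangMills.Theorems.HalvingP1FlatCoreFamilyDoor

end
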